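import Summits.CriticalPhenomena.CardyFormulaZ2.Theses.CardyIKTransport
import Summits.CriticalPhenomena.CardyFormulaZ2.Theses.CardyFlipRusso
import Literature.Probability.Percolation.CardyFormulaConformalInvariance

/-!
# `SmirnovCardyTri` (item stmt-CriticalPhenomena-6432) — proved

The support item `SmirnovCardyTri` of routes `CardyIKTransport` and `CardyFlipRusso` is, by
definition, the Literature named fact
`Literature.Probability.Percolation.hasCrossingLimit_triDomainCrossingProb`
(Smirnov's theorem: Cardy's formula for critical site percolation on the triangular lattice, in
every conformal rectangle, G02 discretisation). That fact is discharged in the tree by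
`Literature.Probability.Percolation.hasCrossingLimit_triDomainCrossingProb_holds`
(`Literature/Probability/Percolation/CardyFormulaConformalInvariance.lean`), so both route
declarations follow by unfolding.
-/

namespace Summit.CriticalPhenomena.CardyFormulaZ2.Theorems

/-- Smirnov's theorem closes the support item `SmirnovCardyTri` of route `CardyIKTransport`:
the route declaration unfolds to the Literature fact
`hasCrossingLimit_triDomainCrossingProb`, proved in the tree. -/
theorem smirnovCardyTri_proof :
    Summit.CriticalPhenomena.CardyFormulaZ2.Theses.CardyIKTransport.SmirnovCardyTri := by
  unfold Summit.CriticalPhenomena.CardyFormulaZ2.Theses.CardyIKTransport.SmirnovCardyTri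
  exact Literature.Probability.Percolation.hasCrossingLimit_triDomainCrossingProb_holds

/-- The same fact closes the identically-stated support item `SmirnovCardyTri` of route
`CardyFlipRusso`. -/
theorem cardyFlipRusso_smirnovCardyTri_proof :
    Summit.CriticalPhenomena.CardyFormulaZ2.Theses.CardyFlipRusso.SmirnovCardyTri := by
  unfold Summit.CriticalPhenomena.CardyFormulaZ2.Theses.CardyFlipRusso.SmirnovCardyTri
  exact Literature.Probability.Percolation.hasCrossingLimit_triDomainCrossingProb_holds

end Summit.CriticalPhenomena.CardyFormulaZ2.Theorems
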